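import Summits.BirchSwinnertonDyer.BirchSwinnertonDyer.Theorems.GenusKolyvaginAtTwoGenusPrimitiveSupplyAtTwoTwistNormClasses
import Summits.BirchSwinnertonDyer.BirchSwinnertonDyer.Theorems.GenusKolyvaginAtTwoGenusPrimitiveSupplyAtTwoArchimedeanDescAdmissible
import Summits.BirchSwinnertonDyer.Rank1Residual.X11b.CongruentSelmerTransferTransport
import HarnessLib

/-!
# Route `GenusKolyvaginAtTwo`, crux #2 `GenusPrimitiveSupplyAtTwo` (stmt-BirchSwinnertonDyer-22136):
# Mazur–Rubin Lemma 2.10 (v)-SHAPE at a finite place modulo the DISPLAYED norm surjectivity —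
# `φ_* 𝓛_v(Wd) = 𝓛_v(W)` as soon as every `K_v`-point of `W` is a norm from `K_v(√d)`

Width seat `bsd-line-gk2-p5` g10 (cell `bsd-f1-sign2`, SUPPLY lineage), file 35 of the series (sequel of `…TwistNormClasses.lean`
p645898). THEOREMS ONLY (no definition, no named fact, no `sorry`, no local instance); helper `--supports stmt-BirchSwinnertonDyer-22136`;
no item is closed; BSD is not proved by any of this.

WHAT. File 34 proved `𝓛_E(W) ≤ φ_* 𝓛_E(Wd)` from the norm-surjectivity hypothesis `hnorm` («every `Γ_E`-fixed point of `W(K̄_E)` is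
`Q + τ₀Q` with `Q` fixed by the index-`2` subgroup fixing `ι√d`»). At a FINITE place `v` of the number field `K` the two local Kummer
conditions have the same (finite) order — `#𝓛_v = #E(K_v)[2] · #(𝓞_v/2)` (tree `natCard_kummerLocalConditionAt_adicCompletion`) and
`#W(K_v)[2] = #Wd(K_v)[2]` along the intertwining (file 25's silent-twist lemma `natCard_ker_nsmul_eq_of_intertwining`) — and `H¹(φ_v)`
is injective (X11b `map_restrictField_injective_of_comp_eq`), so the inclusion is an equality:

* §84 `natCard_kummerLocalConditionAt_adicCompletion_eq_of_intertwining` (`#𝓛_v(Wd) = #𝓛_v(W)`),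
  `natCard_map_kummerLocalConditionAt_adicCompletion_eq` (`#φ_*𝓛_v(Wd) = #𝓛_v(W)`);
* §85 **`map_kummerLocalConditionAt_adicCompletion_eq_of_forall_exists_norm`** — `φ_* 𝓛_v(Wd) = 𝓛_v(W)` modulo `hnorm` ONLY; this is
  Mazur–Rubin Lemma 2.10 (v) («`E` good at `v`, `v` unramified in `K(√d)`») once `hnorm` is fed by Mazur's norm theorem (tree
  `KramerTunnell1982.relIndex_normSubgroup_fixedSubgroup_eq_one_of_isUnit_Δ`; the bridge — `K_v(√d) ≤ maxUnramified K_v`, for `v ∣ 2`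
  i.e. `d ≡ 5 (mod 8)`, and points over `K_v(√d)` vs `W(K̄_v)` — is recorded in the crux memo `Lines/genus-supply-mr-instantiation.md` §8b).
  For `v ∤ 2` the row is already the lead's `GenusKolyTwistTamagawa.transport_kummer_inr_eq_of_not_dvd_localTamagawaNumber`; the new
  reach is the DYADIC place (T-A⁵ `UnramifiedTwistSelmerShiftAtTwo`, `MixedTwistSelmerLevelAtTwo`, `MazurRubin2010.d2_eq_of_lemma210_rat`).

References: [MazurRubin2010] Lemma 2.9, Lemma 2.10 (v); [Kramer1981] Prop. 3, Prop. 7; [MilneADT2006] I Lemma 3.3.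
-/

set_option linter.dupNamespace false -- tree convention: `Summit.BirchSwinnertonDyer.BirchSwinnertonDyer.Theorems` (summit = sub-problem)
set_option autoImplicit false

noncomputable section

open scoped Classical ContRepresentation

namespace Summit.BirchSwinnertonDyer.BirchSwinnertonDyer.Theorems.GenusKolyArch

open WeierstrassCurve Field NumberField IsDedekindDomain Function
open Literature.NumberTheory.EllipticCurves Literature.NumberTheory.GaloisRepresentations
open Summit.BirchSwinnertonDyer.Rank1Residual.X11b.CongruentTransfer (map_restrictField_injective_of_comp_eq)

variable {K : Type} [Field K] [NumberField K] (W : WeierstrassCurve K) [W.IsElliptic]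
  {Wd : WeierstrassCurve K} [Wd.IsElliptic]
  (χ : (Wd.torsionGaloisModule ((2 : ℕ) : ℤ)).toContRepresentation →ⁱL
    (W.torsionGaloisModule ((2 : ℕ) : ℤ)).toContRepresentation)
  (ψ : (W.torsionGaloisModule ((2 : ℕ) : ℤ)).toContRepresentation →ⁱL
    (Wd.torsionGaloisModule ((2 : ℕ) : ℤ)).toContRepresentation)
  (hψχ : ∀ a, ψ (χ a) = a) (hχψ : ∀ b, χ (ψ b) = b)
  (v : HeightOneSpectrum (𝓞 K))

/-! ## §84 The two local Kummer conditions at a finite place have the same order -/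

include hψχ hχψ in
/-- **`#𝓛_v(Wd) = #𝓛_v(W)`** at a finite place, for curves with intertwined `2`-torsion: both are `#E(K_v)[2] · #(𝓞_v/2)`
(`natCard_kummerLocalConditionAt_adicCompletion`) and `#Wd(K_v)[2] = #W(K_v)[2]` (`natCard_ker_nsmul_eq_of_intertwining`).
[cite: MilneADT2006, I Lemma 3.3] [cite: MazurRubin2010, Remark 2.4] -/
theorem natCard_kummerLocalConditionAt_adicCompletion_eq_of_intertwining :
    Nat.card (Wd.kummerLocalConditionAt ((2 : ℕ) : ℤ) (v.adicCompletion K)) =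
      Nat.card (W.kummerLocalConditionAt ((2 : ℕ) : ℤ) (v.adicCompletion K)) := by
  haveI : CharZero (v.adicCompletion K) := charZero_of_injective_algebraMap (algebraMap K _).injective
  rw [Wd.natCard_kummerLocalConditionAt_adicCompletion v two_ne_zero, W.natCard_kummerLocalConditionAt_adicCompletion v two_ne_zero,
    natCard_ker_nsmul_eq_of_intertwining W Wd 2 two_ne_zero χ ψ hψχ hχψ (v.adicCompletion K)]

include hψχ hχψ in
/-- **`#φ_* 𝓛_v(Wd) = #𝓛_v(W)`**: `H¹(φ_v)` is injective (inverse `ψ`). [cite: MazurRubin2010, Remark 2.4, Lemma 3.2] -/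
theorem natCard_map_kummerLocalConditionAt_adicCompletion_eq :
    Nat.card ((Wd.kummerLocalConditionAt ((2 : ℕ) : ℤ) (v.adicCompletion K)).map
        (galoisCohomology.map (χ.restrictField (v.adicCompletion K)) 1)) =
      Nat.card (W.kummerLocalConditionAt ((2 : ℕ) : ℤ) (v.adicCompletion K)) := by
  have hinj : Injective (galoisCohomology.map (χ.restrictField (v.adicCompletion K)) 1) :=
    map_restrictField_injective_of_comp_eq χ ψ hψχ (Sum.inr v)
  rw [AddSubgroup.card_map_of_injective hinj]
  exact natCard_kummerLocalConditionAt_adicCompletion_eq_of_intertwining W χ ψ hψχ hχψ v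

/-! ## §85 Lemma 2.10 (v)-shape at a finite place, modulo the displayed norm surjectivity -/

include hψχ hχψ in
/-- **Mazur–Rubin Lemma 2.10 (v)-shape at a finite place `v`, modulo the DISPLAYED norm surjectivity.** `W, Wd` elliptic over the
number field `K` with inverse intertwinings `χ : Wd[2] → W[2]`, `ψ`; at `E = K_v` the signed untwisting `θ` of file 6
(`exists_addEquiv_geomTorsion_two_localSquare_signed`: `θ(σP) = σθP` / `−σθP` according as `σ` fixes / flips `ι√d`, the dichotomy, and
`ι_*(χ t) = θ(ι_* t)` on `Wd[2]`), `τ₀ ∈ Γ_{K_v}` flipping `ι√d` (so `d ∉ K_v²`), and **`hnorm`: every `Γ_{K_v}`-fixed point of `W(K̄_v)` is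
a norm `Q + τ₀Q` with `Q` fixed by the `σ` fixing `ι√d`** (Mazur: `W` good at `v`, `K_v(√d)/K_v` unramified). THEN
`φ_* 𝓛_v(Wd) = 𝓛_v(W)`: `⊇` is file 34's `kummerLocalConditionAt_le_map_of_forall_exists_norm`, and both sides have the order of §84.
[cite: MazurRubin2010, Lemma 2.9 and Lemma 2.10 (v)] [cite: Kramer1981, Prop. 3 and Prop. 7] -/
theorem map_kummerLocalConditionAt_adicCompletion_eq_of_forall_exists_norm {d : K}
    (θ : localPoints Wd (v.adicCompletion K) ≃+ localPoints W (v.adicCompletion K))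
    (hfix : ∀ σ : absoluteGaloisGroup (v.adicCompletion K),
      (show AlgebraicClosure (v.adicCompletion K) ≃ₐ[v.adicCompletion K] AlgebraicClosure (v.adicCompletion K) from σ)
          (closureEmb (K := K) (v.adicCompletion K) (geomSqrt d)) = closureEmb (K := K) (v.adicCompletion K) (geomSqrt d) →
        ∀ P : localPoints Wd (v.adicCompletion K), θ (σ • P) = σ • θ P)
    (hneg : ∀ σ : absoluteGaloisGroup (v.adicCompletion K),
      (show AlgebraicClosure (v.adicCompletion K) ≃ₐ[v.adicCompletion K] AlgebraicClosure (v.adicCompletion K) from σ)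
          (closureEmb (K := K) (v.adicCompletion K) (geomSqrt d)) = -closureEmb (K := K) (v.adicCompletion K) (geomSqrt d) →
        ∀ P : localPoints Wd (v.adicCompletion K), θ (σ • P) = -(σ • θ P))
    (hdich : ∀ σ : absoluteGaloisGroup (v.adicCompletion K),
      (show AlgebraicClosure (v.adicCompletion K) ≃ₐ[v.adicCompletion K] AlgebraicClosure (v.adicCompletion K) from σ)
          (closureEmb (K := K) (v.adicCompletion K) (geomSqrt d)) = closureEmb (K := K) (v.adicCompletion K) (geomSqrt d) ∨
        (show AlgebraicClosure (v.adicCompletion K) ≃ₐ[v.adicCompletion K] AlgebraicClosure (v.adicCompletion K) from σ)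
          (closureEmb (K := K) (v.adicCompletion K) (geomSqrt d)) = -closureEmb (K := K) (v.adicCompletion K) (geomSqrt d))
    (hχ : ∀ t : geomTorsion Wd ((2 : ℕ) : ℤ),
      pointsMap W (v.adicCompletion K) (χ t : geomPoints W) = θ (pointsMap Wd (v.adicCompletion K) (t : geomPoints Wd)))
    {τ₀ : absoluteGaloisGroup (v.adicCompletion K)}
    (hτ₀ : (show AlgebraicClosure (v.adicCompletion K) ≃ₐ[v.adicCompletion K] AlgebraicClosure (v.adicCompletion K) from τ₀)
        (closureEmb (K := K) (v.adicCompletion K) (geomSqrt d)) = -closureEmb (K := K) (v.adicCompletion K) (geomSqrt d))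
    (hnorm : ∀ P ∈ MulAction.fixedPoints (absoluteGaloisGroup (v.adicCompletion K)) (localPoints W (v.adicCompletion K)),
      ∃ Q : localPoints W (v.adicCompletion K),
        (∀ σ : absoluteGaloisGroup (v.adicCompletion K),
          (show AlgebraicClosure (v.adicCompletion K) ≃ₐ[v.adicCompletion K] AlgebraicClosure (v.adicCompletion K) from σ)
              (closureEmb (K := K) (v.adicCompletion K) (geomSqrt d)) = closureEmb (K := K) (v.adicCompletion K) (geomSqrt d) →
            σ • Q = Q) ∧ Q + τ₀ • Q = P) :
    (Wd.kummerLocalConditionAt ((2 : ℕ) : ℤ) (v.adicCompletion K)).map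
        (galoisCohomology.map (χ.restrictField (v.adicCompletion K)) 1) =
      W.kummerLocalConditionAt ((2 : ℕ) : ℤ) (v.adicCompletion K) := by
  haveI : CharZero (v.adicCompletion K) := charZero_of_injective_algebraMap (algebraMap K _).injective
  have hle := kummerLocalConditionAt_le_map_of_forall_exists_norm W (v.adicCompletion K) χ θ hfix hneg hdich hχ hτ₀ hnorm
  have hc := natCard_map_kummerLocalConditionAt_adicCompletion_eq W χ ψ hψχ hχψ v
  haveI : Finite (W.kummerLocalConditionAt ((2 : ℕ) : ℤ) (v.adicCompletion K)) :=
    W.finite_kummerLocalConditionAt_adicCompletion v two_ne_zero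
  haveI : Nonempty (W.kummerLocalConditionAt ((2 : ℕ) : ℤ) (v.adicCompletion K)) := ⟨0⟩
  haveI : Finite ((Wd.kummerLocalConditionAt ((2 : ℕ) : ℤ) (v.adicCompletion K)).map
      (galoisCohomology.map (χ.restrictField (v.adicCompletion K)) 1)) :=
    Nat.finite_of_card_ne_zero (by rw [hc]; exact Nat.card_pos.ne')
  exact (AddSubgroup.eq_of_le_of_card_ge hle hc.le).symm

end Summit.BirchSwinnertonDyer.BirchSwinnertonDyer.Theorems.GenusKolyArch

end
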